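import Literature.MathematicalPhysics.QuantumLattice.FinDimSpectrum
import Literature.MathematicalPhysics.QuantumLattice.HubbardModel
import Literature.MathematicalPhysics.QuantumLattice.PairCorrelations
import HarnessLib

/-!
# Pairing-channel identities: Zhang's on-site/extended-`s` commutator and Tian's coexistence bound

Trunk T-QLATTICE (`Literature/MathematicalPhysics/QuantumLattice`), family `hubbard`. Two NAMED
FACTS (published results, stated as `def … : Prop`; D-0014; the second is discharged below by
`tian_coexistence_bound_holds`) that ground the
identity layer of route `EnslavedA1g` of summit `HubbardSuperconductivity`
(`Summits/HubbardSuperconductivity/HubbardSuperconductivity/Theses/EnslavedA1g.lean`).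

## Contents

* `zhang_pairing_commutator` — S. Zhang's exact identity between the on-site `s`-wave pair field
  `Δ_s = Σ_x c_{x↑} c_{x↓}` and the extended-`s` (nearest-neighbour singlet bond) pair field of the
  Hubbard Hamiltonian `H(t, U) = -t Σ_{⟨xy⟩σ} (c†_{xσ} c_{yσ} + h.c.) + U Σ_x n_{x↑} n_{x↓}`:
  `[H, Δ_s] = t Δ_{s*} - (U - 2μ) Δ_s` (Zhang, PRB 42 (1990) 1012; printed with the chemical
  potential `μ` of `H - μN`; restated open-access as eq. (4) of You–Gu–Tian–Lin, PRB 79 (2009)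
  014508 = arXiv:0807.1493, whose one-orbital specialisation `t_⊥ = t`, `t_∥ = t₃ = t₄ = U_cd = 0`
  it is). Here at `μ = 0` on the square torus `(ℤ/Lℤ)²`, `L ≥ 3`, in the tree's normalisation:
  `pairField sWave L = √2 Σ_x c_{x↑} c_{x↓}` and
  `pairField extendedSWave L = (1/√2) Σ_x Σ_{e = ±e₁, ±e₂} (c_{x↑} c_{x+e,↓} - c_{x↓} c_{x+e,↑})`,
  so that You et al.'s `N Δ_s = P_s/√2` and `N Δ_{s*} = √2 P_{s*}` and the identity reads
  `H P_s - P_s H = 2t P_{s*} - U P_s`.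
  This grounds `Summit.HubbardSuperconductivity.HubbardSuperconductivity.Theses.EnslavedA1g.EnslavedA1gIdentity`
  (the case `t = 1`, rearranged as `2 P_{s*} = [H, P_s] + U P_s`).
* `tian_coexistence_bound` — G.-S. Tian's inequality (J. Phys. A 30 (1997) 841; as printed in
  You–Gu–Tian–Lin (2009), eqs. (12)–(15)): for an ABSOLUTE ground state `Ψ₀` of a finite-volume
  Hamiltonian `H` (lowest eigenvalue over the whole state space) and ANY operator `A`, with
  `Q := [H, A]`, `⟨Ψ₀, Q† Q Ψ₀⟩ ≤ m(Q) m(A)` where `m(X) = √⟨Ψ₀, [X†, [H, X]] Ψ₀⟩`. Since the double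
  commutators of volume-normalised translation sums are `O(1)`, "`Q` cannot have long-range order
  unless it is shared between at least two of its components" (You et al. (16)–(17)); with
  Zhang's identity (`A = Δ_s`, `Q = t Δ_{s*} - (U - 2μ) Δ_s`) this is Tian's theorem that the
  RVB (= extended-`s`) and on-site pairing long-range orders "either coexist or are suppressed
  simultaneously in the global ground states of the doped Hubbard models" (Tian, J. Phys. A 27
  (1994) 6677, abstract). This grounds the MECHANISM of
  `…Theses.EnslavedA1g.EnslavedA1gUpperSandwich` / `…A1gSlavingTransfer` — which, however, are
  stated for canonical `(N, S^z = 0)`-SECTOR ground states (not absolute ground states of `H - μN`)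
  and therefore carry the extra sector terms `κ₊ = U - (E(N+2,0) - E(N,0))`; they are NOT
  specialisations of this fact.

## Why these are facts and not theorems here

Both are elementary (finite CAR algebra; Cauchy–Schwarz for the positive form `H - E₀`), and the
tree already PROVES the ingredients of the first (`hopTerm_commutator_etaRaise`,
`interaction_commutator_etaRaise`, `commutator_etaRaise` in `FermionOperatorsProofs`, for an
arbitrary sign `ε`, here `ε ≡ 1`; `pairField sWave L = -√2 · etaLower 1`). Discharging them
(`zhang_pairing_commutator_holds`, `tian_coexistence_bound_holds`) is literature-prover work;
this file records the printed statements faithfully so that routes can cite them, and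
`tian_coexistence_bound_holds` is now PROVED at the end of this file (section
`TianCoexistenceProof`: Cauchy–Schwarz for the form `H - E₀` plus Koma–Tasaki's identity).

## Sketch of why `tian_coexistence_bound` holds (You et al. (13); Koma–Tasaki's identity)

For `H Ψ₀ = E₀ Ψ₀` with `E₀ = min spec H` and any `X`:
`⟨Ψ₀, [X†,[H,X]] Ψ₀⟩ = ⟨XΨ₀, (H - E₀) XΨ₀⟩ + ⟨X†Ψ₀, (H - E₀) X†Ψ₀⟩ ≥ ⟨XΨ₀, (H - E₀) XΨ₀⟩ ≥ 0`, and
`⟨QΨ₀, QΨ₀⟩ = ⟨QΨ₀, (H - E₀) A Ψ₀⟩ ≤ ⟨QΨ₀,(H - E₀)QΨ₀⟩^{1/2} ⟨AΨ₀,(H - E₀)AΨ₀⟩^{1/2} ≤ m(Q) m(A)`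
(Cauchy–Schwarz for the positive semidefinite form `H - E₀`).

## Sources

* S. Zhang, *Constraints on s-wave pairing in the Hubbard model*, Phys. Rev. B 42 (1990)
  1012–1014 (abstract: "an exact identity between the on-site and the extended s-wave pairing
  amplitudes … the extended s-wave pairing amplitude vanishes identically at half filling for both
  signs of U. Away from half filling, the existence of an on-site s-wave pairing is a necessary and
  sufficient condition for the existence of an extended s-wave pairing"). Paywalled (acq-01762,
  cite-only); equation read in the open-access restatement below.
* W.-L. You, S.-J. Gu, G.-S. Tian, H.-Q. Lin, *Constraints on the possible pairing symmetry of
  iron arsenide superconductors in a two-orbital model*, Phys. Rev. B 79 (2009) 014508,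
  arXiv:0807.1493: eq. (4) (commutator), eqs. (12)–(17) (coexistence inequality and conclusion),
  refs. [36] = Zhang 1990, [38] = Tian 1997.
* G.-S. Tian, *A sufficient condition for two long-range orders coexisting in a lattice many-body
  system*, J. Phys. A 30 (1997) 841–848 (paywalled, acq-02121); G.-S. Tian, *The inseparability
  of resonating valence bond and on-site pairing long-range orders in doped Hubbard models*,
  J. Phys. A 27 (1994) 6677–6682 (paywalled, acq-02106).
* T. Koma, H. Tasaki, J. Stat. Phys. 76 (1994) 745, proof of Thm 2.2 (the double-commutator
  identity; cf. `horschVonDerLinden` in `KomaTasakiSSB`).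

## Design notes

* Commutators are written out (`H * A - A * H`), as in `etaRaise_commutator`, rather than with
  Mathlib's ring bracket `⁅H, A⁆` (`Ring.lie_def` converts).
* `tian_coexistence_bound` is stated for an arbitrary finite index type and an arbitrary complex
  matrix `A` (the printed `A_k`, `Q_k` are arbitrary lattice operators); the ground-state hypothesis
  is the variational one (`E₀ ≤` every Rayleigh quotient of unit vectors), exactly "absolute ground
  state"; `Ψ₀` need not be normalised (both sides are quadratic in `Ψ₀`). `m(X)` is rendered as
  `Real.sqrt` of the real part of the (real, nonnegative) double-commutator expectation.
* `zhang_pairing_commutator` needs `2 < L`: for `L ≥ 3` the four unit steps `±e₁, ±e₂` project to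
  four distinct neighbours in `(ℤ/Lℤ)²` and `torusGraph 2 L` adjacency is exactly "differ by a unit
  step" (`torusGraph_adj_iff`); at `L = 2` the torus graph is simple while `pairField extendedSWave`
  counts each bond twice, and the identity fails by a factor (refuter check of route EnslavedA1g).
-/

noncomputable section

namespace Literature.MathematicalPhysics.QuantumLattice

open Matrix Finset Literature.Probability.LatticeModels
open scoped ComplexOrder

/-! ### Zhang's on-site / extended-`s` commutator identity -/

/-- **Zhang's identity** (named fact). For the Hubbard Hamiltonian `H = hubbardTorus 2 L t U`
(`= -t Σ_{⟨xy⟩σ} c†_{xσ} c_{yσ}` over ordered adjacent pairs `+ U Σ_x n_{x↑} n_{x↓}`) on the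
square torus `(ℤ/Lℤ)²` with `L ≥ 3`, the on-site pair field `P_s = pairField sWave L`
(`= √2 Σ_x c_{x↑} c_{x↓}`) and the extended-`s` pair field `P_{s*} = pairField extendedSWave L`
(`= (1/√2) Σ_x Σ_{e=±e₁,±e₂} (c_{x↑} c_{x+e,↓} - c_{x↓} c_{x+e,↑})`) satisfy
`H P_s - P_s H = 2t P_{s*} - U P_s`,
i.e. Zhang's `[H, Δ_s] = t Δ_{s*} - (U - 2μ) Δ_s` at `μ = 0` (the kinetic term turns an on-site
pair into the nearest-neighbour singlet bond sum, the interaction counts one doubly-occupied site: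
`[Σ_x n_{x↑}n_{x↓}, Δ_s] = -Δ_s`). Printed for the `d`-dimensional hypercubic lattice with chemical
potential; one-orbital case of You–Gu–Tian–Lin (2009) eq. (4). Grounds
`Summit.HubbardSuperconductivity.HubbardSuperconductivity.Theses.EnslavedA1g.EnslavedA1gIdentity`
(`t = 1`). Source of record: Zhang, PRB 42 (1990) 1012 (bib `ZhangPRB1990`, paywalled); equation read in the
open-access restatement. [cite: YouEtAl2009, eq. (4), one-orbital case = ZhangPRB1990] -/
def zhang_pairing_commutator : Prop :=
  ∀ (L : ℕ) [NeZero L], 2 < L → ∀ (t U : ℝ),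
    hubbardTorus 2 L t U * pairField sWave L - pairField sWave L * hubbardTorus 2 L t U =
      ((2 * t : ℝ) : ℂ) • pairField extendedSWave L - (U : ℂ) • pairField sWave L

/-! ### Tian's coexistence inequality for an absolute ground state -/

/-- **Tian's coexistence bound** (named fact). Let `H` be a Hermitian matrix on a finite index
type, `Ψ₀` an ABSOLUTE ground state (`H Ψ₀ = E₀ Ψ₀` with `E₀ ≤ ⟨φ, H φ⟩` for every unit vector
`φ`), `A` any matrix and `Q = H A - A H = [H, A]`. Then
`⟨Q Ψ₀, Q Ψ₀⟩ ≤ m(Q) · m(A)`, `m(X) = √⟨Ψ₀, [X†, [H, X]] Ψ₀⟩`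
(You–Gu–Tian–Lin (2009) eqs. (13)–(15), after Tian (1997); the double-commutator expectations are
real and nonnegative in a ground state, here rendered as `Real.sqrt` of the real part). With
volume-normalised translation sums `A_k`, both `m`'s are `O(1)`, so `Q_k` has long-range order only
if at least two of its components do ("either all orders are absent or at least two long-range
orders must be present simultaneously", You et al. after (17)); with `zhang_pairing_commutator`
this yields Tian's inseparability of RVB (extended-`s`) and on-site pairing long-range orders in
the global ground states of doped Hubbard models (Tian 1994, abstract). Grounds the mechanism of
`Summit.HubbardSuperconductivity.HubbardSuperconductivity.Theses.EnslavedA1g.EnslavedA1gUpperSandwich`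
(which is the SECTOR-ground-state variant and is not a specialisation of this fact).
Sources of record: Tian, J. Phys. A 30 (1997) 841 (bib `Tian1997`) and J. Phys. A 27 (1994) 6677
(bib `Tian1994`), both paywalled; inequality read in the open-access restatement.
[cite: YouEtAl2009, eqs. (12)-(15) after Tian1997] -/
def tian_coexistence_bound : Prop :=
  ∀ {n : Type} [Fintype n] [DecidableEq n] (H A : Matrix n n ℂ) (ψ : n → ℂ) (E : ℝ),
    H.IsHermitian → H *ᵥ ψ = (E : ℂ) • ψ →
    (∀ φ : n → ℂ, star φ ⬝ᵥ φ = 1 → E ≤ (star φ ⬝ᵥ H *ᵥ φ).re) →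
      let Q : Matrix n n ℂ := H * A - A * H
      (star (Q *ᵥ ψ) ⬝ᵥ (Q *ᵥ ψ)).re ≤
        Real.sqrt (star ψ ⬝ᵥ (Qᴴ * (H * Q - Q * H) - (H * Q - Q * H) * Qᴴ) *ᵥ ψ).re *
          Real.sqrt (star ψ ⬝ᵥ (Aᴴ * (H * A - A * H) - (H * A - A * H) * Aᴴ) *ᵥ ψ).re

/-! ### Discharge of `tian_coexistence_bound`

Proof of You–Gu–Tian–Lin (2009) eq. (13) (after Tian, J. Phys. A 30 (1997) 841), following the
sketch in the module docstring: with `K := H - E₀` (positive semidefinite by the variational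
hypothesis, `K Ψ₀ = 0`),
* Koma–Tasaki's identity `⟨Ψ₀, [X†,[H,X]] Ψ₀⟩ = ⟨XΨ₀, K XΨ₀⟩ + ⟨X†Ψ₀, K X†Ψ₀⟩ ≥ ⟨XΨ₀, K XΨ₀⟩`
  (`tian_double_commutator_expectation`);
* `Q Ψ₀ = [H, A] Ψ₀ = K A Ψ₀`, so `⟨QΨ₀, QΨ₀⟩ = ⟨QΨ₀, K AΨ₀⟩`;
* the Cauchy–Schwarz inequality for the positive semidefinite Hermitian form `⟨u, K v⟩`
  (`tian_re_form_le_sqrt_mul_sqrt`, via the discriminant of `t ↦ ⟨u - t v, K (u - t v)⟩`). -/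

section TianCoexistenceProof

variable {n : Type} [Fintype n]

/-- Hermitian symmetry of the sesquilinear form `⟨u, K v⟩ := star u ⬝ᵥ K *ᵥ v`. [folklore] -/
theorem tian_star_form_of_isHermitian {K : Matrix n n ℂ} (hK : K.IsHermitian) (u v : n → ℂ) :
    star (star u ⬝ᵥ K *ᵥ v) = star v ⬝ᵥ K *ᵥ u := by
  rw [star_dotProduct, star_star, star_mulVec, hK.eq, ← dotProduct_mulVec]

/-- The real part of a Hermitian form is symmetric. [folklore] -/
theorem tian_re_form_symm {K : Matrix n n ℂ} (hK : K.IsHermitian) (u v : n → ℂ) :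
    (star v ⬝ᵥ K *ᵥ u).re = (star u ⬝ᵥ K *ᵥ v).re := by
  rw [← tian_star_form_of_isHermitian hK u v]
  exact Complex.conj_re _

/-- Scaling a vector by a real number scales a sesquilinear form by its square. [folklore] -/
theorem tian_form_real_smul (M : Matrix n n ℂ) (φ : n → ℂ) (r : ℝ) :
    star ((r : ℂ) • φ) ⬝ᵥ M *ᵥ ((r : ℂ) • φ) = ((r * r : ℝ) : ℂ) * (star φ ⬝ᵥ M *ᵥ φ) := by
  rw [star_smul, mulVec_smul, smul_dotProduct, dotProduct_smul, smul_smul, smul_eq_mul]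
  congr 1
  simp

/-- Expansion of the Hermitian form along the real line `t ↦ u - t v` (real parts). [folklore] -/
theorem tian_re_form_sub_smul {K : Matrix n n ℂ} (hK : K.IsHermitian) (u v : n → ℂ) (t : ℝ) :
    (star (u - (t : ℂ) • v) ⬝ᵥ K *ᵥ (u - (t : ℂ) • v)).re =
      (star v ⬝ᵥ K *ᵥ v).re * (t * t) + -(2 * (star u ⬝ᵥ K *ᵥ v).re) * t +
        (star u ⬝ᵥ K *ᵥ u).re := by
  have hsym := tian_re_form_symm hK u v
  have hstar : star ((t : ℂ) • v) = (t : ℂ) • star v := by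
    rw [star_smul]
    congr 1
    simp
  have expand : star (u - (t : ℂ) • v) ⬝ᵥ K *ᵥ (u - (t : ℂ) • v) =
      star u ⬝ᵥ K *ᵥ u - (t : ℂ) * (star u ⬝ᵥ K *ᵥ v) - (t : ℂ) * (star v ⬝ᵥ K *ᵥ u) +
        ((t * t : ℝ) : ℂ) * (star v ⬝ᵥ K *ᵥ v) := by
    rw [star_sub, hstar, mulVec_sub, mulVec_smul, sub_dotProduct, dotProduct_sub, dotProduct_sub,
      smul_dotProduct, smul_dotProduct, dotProduct_smul, dotProduct_smul, smul_smul]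
    simp only [smul_eq_mul]
    push_cast
    ring
  rw [expand, Complex.add_re, Complex.sub_re, Complex.sub_re, Complex.re_ofReal_mul,
    Complex.re_ofReal_mul, Complex.re_ofReal_mul, hsym]
  ring

/-- **Cauchy–Schwarz** for a positive semidefinite Hermitian form on `n → ℂ`:
`Re ⟨u, K v⟩ ≤ √⟨u, K u⟩ √⟨v, K v⟩` (discriminant of `t ↦ ⟨u - t v, K (u - t v)⟩ ≥ 0`).
[folklore] -/
theorem tian_re_form_le_sqrt_mul_sqrt {K : Matrix n n ℂ} (hK : K.IsHermitian)
    (hpsd : ∀ φ : n → ℂ, 0 ≤ (star φ ⬝ᵥ K *ᵥ φ).re) (u v : n → ℂ) :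
    (star u ⬝ᵥ K *ᵥ v).re ≤
      Real.sqrt (star u ⬝ᵥ K *ᵥ u).re * Real.sqrt (star v ⬝ᵥ K *ᵥ v).re := by
  set a := (star u ⬝ᵥ K *ᵥ u).re with ha_def
  set b := (star v ⬝ᵥ K *ᵥ v).re with hb_def
  set c := (star u ⬝ᵥ K *ᵥ v).re with hc_def
  have ha : 0 ≤ a := hpsd u
  have hquad : ∀ t : ℝ, 0 ≤ b * (t * t) + -(2 * c) * t + a := fun t => by
    have h := hpsd (u - (t : ℂ) • v)
    rwa [tian_re_form_sub_smul hK u v t] at h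
  have hdisc := discrim_le_zero hquad
  have hc2 : c ^ 2 ≤ a * b := by
    unfold discrim at hdisc
    nlinarith [hdisc]
  calc c ≤ |c| := le_abs_self c
    _ ≤ Real.sqrt (a * b) := Real.abs_le_sqrt hc2
    _ = Real.sqrt a * Real.sqrt b := Real.sqrt_mul ha b

/-- **Koma–Tasaki's double-commutator identity** in a zero mode of a Hermitian `K`:
`⟨ψ, [Xᴴ, [K, X]] ψ⟩ = ⟨X ψ, K X ψ⟩ + ⟨Xᴴ ψ, K Xᴴ ψ⟩` when `K ψ = 0` (the self-adjoint case
`X = Xᴴ` is the identity behind Koma–Tasaki, J. Stat. Phys. 76 (1994) 745, proof of Thm. 2.2;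
cf. `horschVonDerLinden` in `KomaTasakiSSB`). [folklore] -/
theorem tian_double_commutator_expectation {K X : Matrix n n ℂ} (hK : K.IsHermitian) {ψ : n → ℂ}
    (hψ : K *ᵥ ψ = 0) :
    star ψ ⬝ᵥ (Xᴴ * (K * X - X * K) - (K * X - X * K) * Xᴴ) *ᵥ ψ =
      star (X *ᵥ ψ) ⬝ᵥ K *ᵥ (X *ᵥ ψ) + star (Xᴴ *ᵥ ψ) ⬝ᵥ K *ᵥ (Xᴴ *ᵥ ψ) := by
  have h1 : star ψ ᵥ* K = 0 := by
    have h := congrArg star hψ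
    rwa [star_mulVec, hK.eq, star_zero] at h
  have e1 : star ψ ⬝ᵥ Xᴴ *ᵥ K *ᵥ X *ᵥ ψ = star (X *ᵥ ψ) ⬝ᵥ K *ᵥ (X *ᵥ ψ) := by
    rw [dotProduct_mulVec, star_mulVec]
  have e2 : star ψ ⬝ᵥ K *ᵥ X *ᵥ Xᴴ *ᵥ ψ = 0 := by
    rw [dotProduct_mulVec, h1, zero_dotProduct]
  have e3 : star ψ ⬝ᵥ X *ᵥ K *ᵥ Xᴴ *ᵥ ψ = star (Xᴴ *ᵥ ψ) ⬝ᵥ K *ᵥ (Xᴴ *ᵥ ψ) := by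
    rw [dotProduct_mulVec, star_mulVec, conjTranspose_conjTranspose]
  rw [sub_mulVec, ← mulVec_mulVec, ← mulVec_mulVec, sub_mulVec, sub_mulVec, ← mulVec_mulVec,
    ← mulVec_mulVec, ← mulVec_mulVec, ← mulVec_mulVec, hψ, mulVec_zero, sub_zero, dotProduct_sub,
    dotProduct_sub, e1, e2, e3, zero_sub, sub_neg_eq_add]

/-- **Discharge of `tian_coexistence_bound`** (You–Gu–Tian–Lin, PRB 79 (2009) 014508 =
arXiv:0807.1493, eq. (13) with (14)–(15); Tian, J. Phys. A 30 (1997) 841): for an absolute ground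
state `Ψ₀` of a Hermitian `H` and any `A`, `Q = [H, A]`,
`⟨QΨ₀, QΨ₀⟩ ≤ √⟨Ψ₀,[Q†,[H,Q]]Ψ₀⟩ · √⟨Ψ₀,[A†,[H,A]]Ψ₀⟩`.
Proof: `K := H - E₀ ≥ 0`, `KΨ₀ = 0`, `[H, X] = [K, X]`, `QΨ₀ = K AΨ₀`; Cauchy–Schwarz for the form
`⟨·, K ·⟩` (`tian_re_form_le_sqrt_mul_sqrt`) and Koma–Tasaki's identity
(`tian_double_commutator_expectation`) with `⟨X†Ψ₀, K X†Ψ₀⟩ ≥ 0`.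
[cite: YouEtAl2009, eqs. (12)-(15) after Tian1997] -/
theorem tian_coexistence_bound_holds : tian_coexistence_bound := by
  intro n _ _ H A ψ E hH hψ hvar Q
  -- the shifted Hamiltonian `K = H - E₀`
  set K : Matrix n n ℂ := H - (E : ℂ) • (1 : Matrix n n ℂ) with hK_def
  have hK : K.IsHermitian := hH.sub (isHermitian_one.smul (Complex.conj_ofReal E))
  have hKψ : K *ᵥ ψ = 0 := by
    rw [hK_def, sub_mulVec, smul_mulVec, one_mulVec, hψ, sub_self]
  have hcomm : ∀ X : Matrix n n ℂ, H * X - X * H = K * X - X * K := by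
    intro X
    simp only [hK_def, sub_mul, mul_sub, Matrix.smul_mul, Matrix.mul_smul, Matrix.one_mul,
      Matrix.mul_one]
    abel
  -- `K` is positive semidefinite (variational characterisation of the absolute ground state)
  have hpsd : ∀ φ : n → ℂ, 0 ≤ (star φ ⬝ᵥ K *ᵥ φ).re := by
    intro φ
    have hKφ : star φ ⬝ᵥ K *ᵥ φ = star φ ⬝ᵥ H *ᵥ φ - (E : ℂ) * (star φ ⬝ᵥ φ) := by
      rw [hK_def, sub_mulVec, smul_mulVec, one_mulVec, dotProduct_sub, dotProduct_smul,
        smul_eq_mul]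
    -- `star φ ⬝ᵥ φ = ‖φ‖²` is a nonnegative real
    set s : ℝ := (star φ ⬝ᵥ φ).re with hs_def
    have hnn : (0 : ℂ) ≤ star φ ⬝ᵥ φ := dotProduct_star_self_nonneg φ
    have hs : star φ ⬝ᵥ φ = (s : ℂ) := by
      apply Complex.ext
      · simp [hs_def]
      · rw [Complex.ofReal_im]
        exact ((Complex.nonneg_iff.mp hnn).2).symm
    have hs0 : 0 ≤ s := by
      have h := (Complex.nonneg_iff.mp hnn).1
      rwa [hs, Complex.ofReal_re] at h
    by_cases hφ : φ = 0
    · subst hφ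
      simp
    -- normalise `φ` and apply the variational hypothesis
    have hs_ne : s ≠ 0 := by
      intro h0
      apply hφ
      rw [← dotProduct_star_self_eq_zero, hs, h0, Complex.ofReal_zero]
    have hs_pos : 0 < s := lt_of_le_of_ne hs0 (Ne.symm hs_ne)
    set r : ℝ := (Real.sqrt s)⁻¹ with hr_def
    have hrr : r * r * s = 1 := by
      rw [hr_def, ← mul_inv, Real.mul_self_sqrt hs0, inv_mul_cancel₀ hs_ne]
    have hunit : star ((r : ℂ) • φ) ⬝ᵥ ((r : ℂ) • φ) = 1 := by
      have h := tian_form_real_smul (1 : Matrix n n ℂ) φ r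
      rw [one_mulVec, one_mulVec, hs] at h
      rw [h]
      exact_mod_cast hrr
    have hE := hvar ((r : ℂ) • φ) hunit
    rw [tian_form_real_smul H φ r, Complex.re_ofReal_mul] at hE
    -- `E ≤ r² ⟨φ, H φ⟩`, i.e. `E s ≤ ⟨φ, H φ⟩`
    have hmain : E * s ≤ (star φ ⬝ᵥ H *ᵥ φ).re := by
      have h := mul_le_mul_of_nonneg_right hE hs0
      calc E * s ≤ r * r * (star φ ⬝ᵥ H *ᵥ φ).re * s := h
        _ = (r * r * s) * (star φ ⬝ᵥ H *ᵥ φ).re := by ring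
        _ = (star φ ⬝ᵥ H *ᵥ φ).re := by rw [hrr, one_mul]
    rw [hKφ, hs, Complex.sub_re, ← Complex.ofReal_mul, Complex.ofReal_re]
    linarith
  -- `[H, X] = [K, X]` and `Q Ψ₀ = K A Ψ₀`
  have hQK : H * Q - Q * H = K * Q - Q * K := hcomm Q
  have hAK : H * A - A * H = K * A - A * K := hcomm A
  have hQψ : Q *ᵥ ψ = K *ᵥ A *ᵥ ψ := by
    show (H * A - A * H) *ᵥ ψ = K *ᵥ A *ᵥ ψ
    rw [hAK, sub_mulVec, ← mulVec_mulVec, ← mulVec_mulVec, hKψ, mulVec_zero, sub_zero]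
  show (star (Q *ᵥ ψ) ⬝ᵥ Q *ᵥ ψ).re ≤
    Real.sqrt (star ψ ⬝ᵥ (Qᴴ * (H * Q - Q * H) - (H * Q - Q * H) * Qᴴ) *ᵥ ψ).re *
      Real.sqrt (star ψ ⬝ᵥ (Aᴴ * (H * A - A * H) - (H * A - A * H) * Aᴴ) *ᵥ ψ).re
  rw [hQK, hAK, tian_double_commutator_expectation hK hKψ,
    tian_double_commutator_expectation hK hKψ]
  calc (star (Q *ᵥ ψ) ⬝ᵥ Q *ᵥ ψ).re = (star (Q *ᵥ ψ) ⬝ᵥ K *ᵥ A *ᵥ ψ).re := by rw [← hQψ]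
    _ ≤ Real.sqrt (star (Q *ᵥ ψ) ⬝ᵥ K *ᵥ (Q *ᵥ ψ)).re *
          Real.sqrt (star (A *ᵥ ψ) ⬝ᵥ K *ᵥ (A *ᵥ ψ)).re :=
        tian_re_form_le_sqrt_mul_sqrt hK hpsd _ _
    _ ≤ Real.sqrt (star (Q *ᵥ ψ) ⬝ᵥ K *ᵥ (Q *ᵥ ψ) + star (Qᴴ *ᵥ ψ) ⬝ᵥ K *ᵥ (Qᴴ *ᵥ ψ)).re *
          Real.sqrt (star (A *ᵥ ψ) ⬝ᵥ K *ᵥ (A *ᵥ ψ) + star (Aᴴ *ᵥ ψ) ⬝ᵥ K *ᵥ (Aᴴ *ᵥ ψ)).re := by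
        apply mul_le_mul (Real.sqrt_le_sqrt _) (Real.sqrt_le_sqrt _) (Real.sqrt_nonneg _)
          (Real.sqrt_nonneg _)
        · rw [Complex.add_re]
          linarith [hpsd (Qᴴ *ᵥ ψ)]
        · rw [Complex.add_re]
          linarith [hpsd (Aᴴ *ᵥ ψ)]

end TianCoexistenceProof

end Literature.MathematicalPhysics.QuantumLattice
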